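import Summits.KontsevichZagierPeriods.Zeta5Search.Barrier.ConeGammaS7CritOrbit

/-!
# ζ(5) search — BARRIER: the block subgroup unconditionally, and the sorted-chamber reduction on non-degenerate orbits

HONEST FRAMING (cell `pub-zeta5`): systematic search; no irrationality claim unless kernel-certified. MODEL objects
under Brown–Zudilin's (28)+(30) accounting ([BZ22] = arXiv:2210.03391; (28) observed, not proved); statements about
BZ's §5 critical system under the hypergeometric group and about the MODEL rate function `γ`; nothing here is about
the size of any critical value, the cone's supremum (C2 = `BarrierC2`, OPEN), S-E (CONJECTURED) or `ζ(5)`. No number or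
sentence of record moves. Records in print UNMOVED. Prover P2 g21 (self-selected Lean-only item, file 7).

* **`critVals_permAct_of_mem_blockClosure`** — for every `g` in the BLOCK submonoid generated by `(34)`, `(45)` and BZ's
  reversal `π` (the 72-element stabiliser of the block system `{s₃,s₄,s₅} | {s₁,s₂,s₇}`), `critVals (g·a) = critVals a + ΔE(g;a)`
  for EVERY direction `a` — no box, no loss condition; hence `gamma_permAct_of_mem_blockClosure`: `γ(g·a) = γ(a)` at every
  Regular direction of the closed box, and `regular_permAct_of_mem_blockClosure`.
* **`gamma_le_of_sorted_of_nondegenerate`** — the HONEST form of the cell's «S₇ reduction to the sorted chamber»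
  (`ConeGammaRates.coneSupBound_iff_height_one`'s gloss; P2 g20's `coneSupBound_iff_sorted_of_critShift` was conditional
  on a hypothesis that `ConeGammaS7CritWitness` shows is not satisfiable as a ∀-statement): IF `γ ≤ γ*` at every SORTED
  Regular direction of the cone, THEN `γ(a) ≤ γ*` at every Regular direction `a` of the cone lying in the open box whose
  `S₇`-orbit is loss-free for `(56)`; `coneSupBound_of_sorted_of_nondegenerate` — the same as an implication towards
  `ConeSupBound γ*` RESTRICTED to such directions. The loss loci (codimension one) are NOT covered; nothing is claimed there.
-/

noncomputable section

open Finset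

namespace Summit.KontsevichZagierPeriods.Zeta5Search.Barrier.ConeGamma

/-! ### The block submonoid `⟨(34), (45), π⟩`: unconditional -/

/-- **The set cocycle for the whole block submonoid, every direction.** -/
theorem critVals_permAct_of_mem_blockClosure {g : Equiv.Perm (Fin 7)}
    (hg : g ∈ Submonoid.closure ({Equiv.swap 2 3, Equiv.swap 3 4, Equiv.swap 0 3 * Equiv.swap 1 2 * Equiv.swap 4 6} :
      Set (Equiv.Perm (Fin 7)))) (a : Dir) :
    critVals (permAct g a) = (fun v => v + ∑ i ∈ FIdx, (h28 (permAct g a) i * Real.log (h28 (permAct g a) i)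
      - h28 a i * Real.log (h28 a i))) '' critVals a := by
  have hS : ∀ b ∈ (Set.univ : Set Dir), ∀ g : Equiv.Perm (Fin 7), permAct g b ∈ (Set.univ : Set Dir) :=
    fun _ _ _ => Set.mem_univ _
  revert a
  suffices h : ∀ a ∈ (Set.univ : Set Dir), critVals (permAct g a) = (fun v => v + ∑ i ∈ FIdx,
      (h28 (permAct g a) i * Real.log (h28 (permAct g a) i) - h28 a i * Real.log (h28 a i))) '' critVals a from
    fun a => h a (Set.mem_univ a)
  induction hg using Submonoid.closure_induction with
  | one => exact fun a _ => critShift_one a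
  | mul τ₁ τ₂ _ _ h₁ h₂ => exact critShift_mul hS h₁ h₂
  | mem τ hτ =>
    simp only [Set.mem_insert_iff, Set.mem_singleton_iff] at hτ
    rcases hτ with rfl | rfl | rfl
    · exact fun a _ => critVals_permAct_swap23 a
    · exact fun a _ => critVals_permAct_swap34 a
    · exact fun a _ => critVals_permAct_mirror a

/-- `Regular` is invariant under the block submonoid (every direction). -/
theorem regular_permAct_of_mem_blockClosure {g : Equiv.Perm (Fin 7)}
    (hg : g ∈ Submonoid.closure ({Equiv.swap 2 3, Equiv.swap 3 4, Equiv.swap 0 3 * Equiv.swap 1 2 * Equiv.swap 4 6} :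
      Set (Equiv.Perm (Fin 7)))) {a : Dir} (hreg : Regular a) : Regular (permAct g a) :=
  regular_of_critVals_eq_image hreg (critVals_permAct_of_mem_blockClosure hg a)

/-- **`γ` is invariant under the block submonoid** at every Regular direction of the closed box (no loss condition). -/
theorem gamma_permAct_of_mem_blockClosure {g : Equiv.Perm (Fin 7)}
    (hg : g ∈ Submonoid.closure ({Equiv.swap 2 3, Equiv.swap 3 4, Equiv.swap 0 3 * Equiv.swap 1 2 * Equiv.swap 4 6} :
      Set (Equiv.Perm (Fin 7)))) {a : Dir} (ha : BZBox a) (hreg : Regular a) : gamma (permAct g a) = gamma a := by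
  have hcv := critVals_permAct_of_mem_blockClosure hg a
  exact gamma_permAct_of_critShift ha g (C1_of_critVals_eq_image hreg hcv) (C0_of_critVals_eq_image hreg hcv)

/-! ### The sorted-chamber reduction, honestly: on non-degenerate orbits -/

/-- **From the sorted chamber to a non-degenerate orbit.** If `γ ≤ γ*` at every SORTED (`s₁ ≤ … ≤ s₇`) Regular direction
of the cone, then `γ(a) ≤ γ*` at every Regular direction `a` of the cone that lies in the open box and whose `S₇`-orbit
is loss-free for `(56)` (the hypothesis of `critVals_permAct_of_nondegenerate`). -/
theorem gamma_le_of_sorted_of_nondegenerate (γs : ℝ)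
    (hsorted : ∀ b ∈ BZCone, Monotone (fun j : Fin 7 => sParam b j.succ) → Regular b → gamma b ≤ γs)
    {a : Dir} (ha : a ∈ BZCone) (hbox : ∀ j : Fin 7, 0 < sParam a j.succ ∧ sParam a j.succ < sParam a 0)
    (hN : ∀ (g : Equiv.Perm (Fin 7)) (x y : ℝ), IsCritical (permAct g a) x y →
      y - sParam (permAct g a) 6 + sParam (permAct g a) 5 ≠ 0
      ∧ (y - sParam (permAct g a) 6 + sParam (permAct g a) 5)
          * ((sParam (permAct g a) 1 + sParam (permAct g a) 2 + sParam (permAct g a) 6 + sParam (permAct g a) 7 - y)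
            * (sParam (permAct g a) 0 + sParam (permAct g a) 6 - y))
        - (y - (sParam (permAct g a) 1 + sParam (permAct g a) 6)) * (y - (sParam (permAct g a) 2 + sParam (permAct g a) 6))
          * (y - (sParam (permAct g a) 6 + sParam (permAct g a) 7)) ≠ 0)
    (hreg : Regular a) : gamma a ≤ γs := by
  obtain ⟨g, hg⟩ := exists_permAct_sorted a
  have h := hsorted (permAct g a) (BZCone_permAct ha g) hg (regular_permAct_of_nondegenerate hbox hN hreg g)
  rwa [gamma_permAct_of_nondegenerate hbox hN hreg g] at h

/-- **`ConeSupBound γ*` restricted to non-degenerate open-box orbits follows from the sorted-chamber bound** (the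
loss loci and the closed-box faces are NOT covered by this implication). -/
theorem coneSupBound_of_sorted_of_nondegenerate (γs : ℝ)
    (hsorted : ∀ b ∈ BZCone, Monotone (fun j : Fin 7 => sParam b j.succ) → Regular b → gamma b ≤ γs) :
    ∀ a ∈ BZCone, (∀ j : Fin 7, 0 < sParam a j.succ ∧ sParam a j.succ < sParam a 0) →
      (∀ (g : Equiv.Perm (Fin 7)) (x y : ℝ), IsCritical (permAct g a) x y →
        y - sParam (permAct g a) 6 + sParam (permAct g a) 5 ≠ 0
        ∧ (y - sParam (permAct g a) 6 + sParam (permAct g a) 5)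
            * ((sParam (permAct g a) 1 + sParam (permAct g a) 2 + sParam (permAct g a) 6 + sParam (permAct g a) 7 - y)
              * (sParam (permAct g a) 0 + sParam (permAct g a) 6 - y))
          - (y - (sParam (permAct g a) 1 + sParam (permAct g a) 6)) * (y - (sParam (permAct g a) 2 + sParam (permAct g a) 6))
            * (y - (sParam (permAct g a) 6 + sParam (permAct g a) 7)) ≠ 0) →
      Regular a → gamma a ≤ γs :=
  fun _ ha hbox hN hreg => gamma_le_of_sorted_of_nondegenerate γs hsorted ha hbox hN hreg

end Summit.KontsevichZagierPeriods.Zeta5Search.Barrier.ConeGamma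

end
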